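import Summits.ResolutionOfSingularities.ResolutionOfSingularities.Theorems.UniversalCellsCampaignW82DifferentialCriterion
import Literature.AlgebraicGeometry.Resolution.RegularImpliesSmooth
import Literature.AlgebraicGeometry.Resolution.SmoothUniformizationProofs
import Mathlib.FieldTheory.RatFunc.AsPolynomial
import Mathlib.RingTheory.Kaehler.Polynomial
import Mathlib.RingTheory.Smooth.Field
import HarnessLib

/-!
# [OURS · L1 W8.2] THE 1-FORM CRITERION FOR THE SLOT: a regular local ring essentially of finite type over `M(t)`
# (`M` perfect) is formally smooth over `M(t)` iff the 1-form `dt` does not vanish at its closed point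

Cell `res-hironaka` (run/shared/lean/pub/res-hironaka/), LADDER-RESOLUTION rung L (RESCUE), slot W8.2; host route
`UniversalCells`, host item `PrimeFieldToPerfect` (stmt-ResolutionOfSingularities-15233), door 1. Proofs file
(Theses-free), written by res-L1-s82-pv-1 (gen 7); companion of `…DifferentialCriterion` (the criterion for an
arbitrary tower `k → K → B`). Here `k = M` is a PERFECT field and `K = M(t) = RatFunc M`, the ground field of every
normal form of the W8.2 residual (`FrobeniusTwistStepRegularAt p M n` & co.):

* `exists_basis_kaehlerDifferential_ratFunc` — `Ω_{M(t)/M}` is free of rank one on `dt` (any field `M`;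
  `Ω_{M[t]/M} = M[t] dt` and `M[t] → M(t)` is formally étale).
* `formallySmooth_of_isRegularLocalRing_of_perfectField` / `formallySmooth_iff_isRegularLocalRing_of_perfectField` —
  for a local ring `B` essentially of finite type over a PERFECT field `M`: `B` is formally smooth over `M` iff `B` is
  a regular local ring (Stacks 00TV at the closed point, whose residue field is separable over the perfect `M`, and
  EGA IV₄ 17.5.8 (iii) / Görtz–Wedhorn 6.26 from the tree).
* **`ratFunc_formallySmooth_iff_tmul_D_ne_zero`** — THE SLOT'S (E6): for `B` local, essentially of finite type over
  `M(t)`, `M` perfect, `B` REGULAR: `B` is formally smooth over `M(t)` iff `1 ⊗ dt ≠ 0` in `κ(B) ⊗_B Ω_{B/M}`.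
  (`ratFunc_formallySmooth_iff_tmul_D_ne_zero_of_formallySmooth`: the same for any field `M` under «`B` formally
  smooth over `M`, `Ω_{B/M}` finite».)
* `ratFunc_isSmoothAt_iff_tmul_D_ne_zero` — at a prime `𝔭` of an `M(t)`-algebra `A` essentially of finite type
  with `A_𝔭` regular: `A` is `M(t)`-smooth at `𝔭` iff `dt(𝔭) := 1 ⊗ dt ≠ 0` in `κ(𝔭) ⊗ Ω_{A_𝔭/M}`;
  **`ratFunc_smooth_iff_forall_tmul_D_ne_zero`** — GLOBAL: a regular `A` of finite type over `M(t)` is smooth over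
  `M(t)` iff `dt(𝔭) ≠ 0` at every prime: «the 1-form `dt` vanishes nowhere on `Spec A`».

READING for slot W8.2. In every normal form of the residual («some Frobenius twist `X₀^{(p^e)}` of the regular,
geometrically integral `X₀ / M(t)` has a SMOOTH proper birational model `Y`»; gens 2–6: smooth ⟺ `Y^{(p)}` regular ⟺
`F_{Y/K}` flat ⟺ `Y ×_K Y` regular) one may now read SMOOTH as: `Y` is regular and THE 1-FORM `dt` (the differential
over the constants `M` of the coordinate `t` of the ground field `M(t)`, a global section of the locally free sheaf
`Ω_{Y/M}` of rank `dim Y + 1`) VANISHES NOWHERE on `Y` — the non-smooth locus of a regular model is the zero scheme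
of `dt`. The residual therefore asks, given resolution over `M(t)`, for a resolution of some twist that also
«resolves» the zeros of one closed 1-form. This is the lever of idea card `faltings-one-step-fibre-principle`
(stmt-8933) in kernel-checked form; it is a NORMAL FORM, not progress on the open residual (`n ≥ 4`).

HONEST FRAMING. OURS theorems (classical: EGA 0_IV 20.5.7, Stacks 00TV, EGA IV₄ 17.5.8 (iii), assembled from Mathlib
and the tree); they replace the role of no printed item of [Hironaka2017] and are NOT statements of the manuscript;
nothing is attributed to its author. AI work, weaker than expert review; no claim beyond the kernel. No `sorry`, no
new axioms.

## References (locators only)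
* A. Grothendieck, *EGA 0_IV* (Publ. Math. IHÉS 20, 1964), Thm. 20.5.7 (ii); *EGA IV₄* (ibid. 32, 1967), 17.5.8 (iii),
  17.15.
* U. Görtz, T. Wedhorn, *Algebraic Geometry II* (2023), Lemma 6.26. [GortzWedhorn2020]
* The Stacks Project, Tags 00TV, 00S2. [StacksProject]
-/

noncomputable section

set_option linter.dupNamespace false -- mandated namespace of this single-conjunct summit

open IsLocalRing TensorProduct KaehlerDifferential Polynomial
open scoped RatFunc
open Literature.AlgebraicGeometry.Resolution

namespace Summit.ResolutionOfSingularities.ResolutionOfSingularities.Theorems.CampaignW82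

universe u

/-! ## §1 `Ω_{M(t)/M} = M(t)·dt` -/

section RatFuncBasis

variable (M : Type u) [Field M]

/-- `M(t)` is essentially of finite type over `M` (a localization of `M[t]`). [folklore] -/
theorem essFiniteType_ratFunc : Algebra.EssFiniteType M (RatFunc M) :=
  haveI : Algebra.EssFiniteType M[X] (RatFunc M) :=
    Algebra.EssFiniteType.of_isLocalization (R := M[X]) (S := RatFunc M) (nonZeroDivisors M[X])
  Algebra.EssFiniteType.comp M M[X] (RatFunc M)

/-- `M[t] → M(t)` is formally étale (a localization). [folklore] -/
theorem formallyEtale_polynomial_ratFunc : Algebra.FormallyEtale M[X] (RatFunc M) :=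
  Algebra.FormallyEtale.of_isLocalization (Rₘ := RatFunc M) (nonZeroDivisors M[X])

/-- **`Ω_{M(t)/M}` is free of rank one on `dt`**: there is an `M(t)`-basis of `Ω_{M(t)/M}` indexed by a singleton
whose element is `d(t)` (`t = RatFunc.X`). (`Ω_{M[t]/M} = M[t]·dt`, Mathlib `KaehlerDifferential.polynomialEquiv`,
transported along the formally étale `M[t] → M(t)`, Mathlib `tensorKaehlerEquivOfFormallyEtale`.) [folklore] -/
theorem exists_basis_kaehlerDifferential_ratFunc :
    ∃ b : Module.Basis (Fin 1) (RatFunc M) Ω[RatFunc M⁄M],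
      b default = KaehlerDifferential.D M (RatFunc M) RatFunc.X := by
  haveI := formallyEtale_polynomial_ratFunc M
  -- `Ω_{M[t]/M}` with basis `dt`
  let b₀ : Module.Basis (Fin 1) M[X] Ω[M[X]⁄M] :=
    (Module.Basis.singleton (Fin 1) M[X]).map (KaehlerDifferential.polynomialEquiv M).symm
  have hb₀ : b₀ default = KaehlerDifferential.D M M[X] Polynomial.X := by
    change (KaehlerDifferential.polynomialEquiv M).symm (Module.Basis.singleton (Fin 1) M[X] default) = _
    rw [Module.Basis.singleton_apply, KaehlerDifferential.polynomialEquiv_symm, one_smul]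
  -- transport along `M(t) ⊗_{M[t]} Ω_{M[t]/M} ≃ Ω_{M(t)/M}`
  refine ⟨(Algebra.TensorProduct.basis (RatFunc M) b₀).map
    (KaehlerDifferential.tensorKaehlerEquivOfFormallyEtale M M[X] (RatFunc M)), ?_⟩
  rw [Module.Basis.map_apply, Algebra.TensorProduct.basis_apply, hb₀, ← LinearEquiv.eq_symm_apply,
    ← RatFunc.algebraMap_X, KaehlerDifferential.tensorKaehlerEquivOfFormallyEtale_symm_D_algebraMap]

end RatFuncBasis

/-! ## §2 Regular ⟺ formally smooth over a perfect field (local rings essentially of finite type) -/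

section Perfect

variable (M B : Type u) [Field M] [CommRing B] [Algebra M B]

/-- **A regular local ring essentially of finite type over a perfect field is formally smooth over it** (Stacks 00TV
at the closed point: write `B = (A₀)_{q₀}` with `A₀` of finite type over `M`; the residue field `κ(q₀)` is essentially
of finite type over the PERFECT field `M`, hence separable = formally smooth over `M`, and a regular local ring with
formally smooth residue field is a smooth point). [cite: StacksProject, Tag 00TV] -/
theorem formallySmooth_of_isRegularLocalRing_of_perfectField [PerfectField M] [Algebra.EssFiniteType M B]
    [IsRegularLocalRing B] : Algebra.FormallySmooth M B := by
  let A₀ : Subalgebra M B := Algebra.EssFiniteType.subalgebra M B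
  haveI : Algebra.FinitePresentation M A₀ :=
    (Algebra.FinitePresentation.of_finiteType (R := M) (A := A₀)).mp inferInstance
  let q₀ : Ideal A₀ := (maximalIdeal B).comap (algebraMap A₀ B)
  haveI hq₀ : q₀.IsPrime := Ideal.comap_isPrime _ _
  -- `B` is the localization of `A₀` at `q₀`
  haveI : IsLocalization.AtPrime B q₀ := by
    refine IsLocalization.of_le (Algebra.EssFiniteType.submonoid M B) q₀.primeCompl ?_ ?_
    · intro a ha haq
      have hu : IsUnit (algebraMap A₀ B a) := ha
      exact (IsLocalRing.mem_maximalIdeal _).mp (Ideal.mem_comap.mp haq) hu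
    · intro a ha
      by_contra hu
      exact ha (Ideal.mem_comap.mpr ((IsLocalRing.mem_maximalIdeal _).mpr hu))
  let e : B ≃ₐ[M] Localization.AtPrime q₀ :=
    (IsLocalization.algEquiv q₀.primeCompl B (Localization.AtPrime q₀)).restrictScalars M
  haveI : IsRegularLocalRing (Localization.AtPrime q₀) := IsRegularLocalRing.of_ringEquiv e.toRingEquiv
  -- the residue field of `(A₀)_{q₀}` is essentially of finite type over the perfect `M`, hence formally smooth
  haveI : Algebra.EssFiniteType M (ResidueField (Localization.AtPrime q₀)) :=
    inferInstanceAs (Algebra.EssFiniteType M (Localization.AtPrime q₀ ⧸ maximalIdeal (Localization.AtPrime q₀)))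
  haveI : Algebra.FormallySmooth M (ResidueField (Localization.AtPrime q₀)) :=
    Algebra.FormallySmooth.of_perfectField
  haveI : Algebra.IsSmoothAt M q₀ :=
    isSmoothAt_of_isRegularLocalRing_of_formallySmooth_residueField M A₀ q₀
  exact Algebra.FormallySmooth.of_equiv e.symm

/-- **Regular ⟺ formally smooth over a perfect field**, for local rings essentially of finite type over `M` (⇐ is the
tree's `isRegularLocalRing_of_formallySmooth_of_essFiniteType`, any field). [cite: StacksProject, Tag 00TV] -/
theorem formallySmooth_iff_isRegularLocalRing_of_perfectField [IsLocalRing B] [PerfectField M]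
    [Algebra.EssFiniteType M B] : Algebra.FormallySmooth M B ↔ IsRegularLocalRing B := by
  constructor
  · intro h
    exact isRegularLocalRing_of_formallySmooth_of_essFiniteType M B
  · intro h
    exact formallySmooth_of_isRegularLocalRing_of_perfectField M B

end Perfect

/-! ## §3 (E6) for the slot: `K = M(t)`, `M` perfect -/

section Slot

variable (M B : Type u) [Field M] [CommRing B] [Algebra M B] [Algebra (RatFunc M) B]
  [IsScalarTower M (RatFunc M) B]

/-- **The 1-form criterion over `M(t)`, formally smooth version** (any field `M`; `B` local, formally smooth over
`M`, `Ω_{B/M}` finite): `B` is formally smooth over `M(t)` iff `1 ⊗ dt ≠ 0` in `κ(B) ⊗_B Ω_{B/M}`.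
[cite: EGA0IV, Thm. 20.5.7] -/
theorem ratFunc_formallySmooth_iff_tmul_D_ne_zero_of_formallySmooth [IsLocalRing B] [Algebra.FormallySmooth M B]
    [Module.Finite B Ω[B⁄M]] :
    Algebra.FormallySmooth (RatFunc M) B ↔
      (1 : ResidueField B) ⊗ₜ[B] KaehlerDifferential.D M B (algebraMap (RatFunc M) B RatFunc.X) ≠ 0 := by
  obtain ⟨b, hb⟩ := exists_basis_kaehlerDifferential_ratFunc M
  exact formallySmooth_iff_tmul_D_ne_zero M (RatFunc M) B b RatFunc.X hb

/-- **THE 1-FORM CRITERION FOR SLOT W8.2 (form (E6) of Cruxes/PrimeFieldToPerfect/KERNEL.md §2)**: for `M` PERFECT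
and `B` a REGULAR local ring essentially of finite type over `M(t)` (e.g. `𝒪_{Y,y}` for `Y` regular, locally of
finite type over `M(t)`): `B` is formally smooth over `M(t)` iff `1 ⊗ dt ≠ 0` in `κ(B) ⊗_B Ω_{B/M}` — «`Y` is smooth
over `M(t)` at `y` iff the 1-form `dt` does not vanish at `y`». [cite: EGA0IV, Thm. 20.5.7] -/
theorem ratFunc_formallySmooth_iff_tmul_D_ne_zero [PerfectField M] [Algebra.EssFiniteType (RatFunc M) B]
    [IsRegularLocalRing B] :
    Algebra.FormallySmooth (RatFunc M) B ↔
      (1 : ResidueField B) ⊗ₜ[B] KaehlerDifferential.D M B (algebraMap (RatFunc M) B RatFunc.X) ≠ 0 := by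
  haveI := essFiniteType_ratFunc M
  haveI : Algebra.EssFiniteType M B := Algebra.EssFiniteType.comp M (RatFunc M) B
  haveI : Algebra.FormallySmooth M B := formallySmooth_of_isRegularLocalRing_of_perfectField M B
  exact ratFunc_formallySmooth_iff_tmul_D_ne_zero_of_formallySmooth M B

end Slot

/-! ## §4 At a prime, and globally, for algebras over `M(t)` -/

section SlotAlgebra

variable (M A : Type u) [Field M] [PerfectField M] [CommRing A] [Algebra M A] [Algebra (RatFunc M) A]
  [IsScalarTower M (RatFunc M) A]

/-- **(E6) at a prime**: `A` essentially of finite type over `M(t)` (`M` perfect), `𝔭 ⊂ A` prime with `A_𝔭` regular: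
`A` is `M(t)`-smooth at `𝔭` iff `dt(𝔭) := 1 ⊗ dt ≠ 0` in `κ(𝔭) ⊗ Ω_{A_𝔭/M}`. [cite: EGA0IV, Thm. 20.5.7] -/
theorem ratFunc_isSmoothAt_iff_tmul_D_ne_zero [Algebra.EssFiniteType (RatFunc M) A] (𝔭 : Ideal A) [𝔭.IsPrime]
    [IsRegularLocalRing (Localization.AtPrime 𝔭)] :
    Algebra.IsSmoothAt (RatFunc M) 𝔭 ↔
      (1 : 𝔭.ResidueField) ⊗ₜ[Localization.AtPrime 𝔭]
        KaehlerDifferential.D M (Localization.AtPrime 𝔭)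
          (algebraMap (RatFunc M) (Localization.AtPrime 𝔭) RatFunc.X) ≠ 0 :=
  ratFunc_formallySmooth_iff_tmul_D_ne_zero M (Localization.AtPrime 𝔭)

/-- **(E6) globally — «`dt` vanishes nowhere»**: a REGULAR `A` of finite type over `M(t)` (`M` perfect) is smooth
over `M(t)` iff `dt(𝔭) ≠ 0` at every prime `𝔭` of `A`. [cite: EGA0IV, Thm. 20.5.7] -/
theorem ratFunc_smooth_iff_forall_tmul_D_ne_zero [Algebra.FiniteType (RatFunc M) A] [IsRegularRing A] :
    Algebra.Smooth (RatFunc M) A ↔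
      ∀ (𝔭 : Ideal A) [𝔭.IsPrime],
        (1 : 𝔭.ResidueField) ⊗ₜ[Localization.AtPrime 𝔭]
          KaehlerDifferential.D M (Localization.AtPrime 𝔭)
            (algebraMap (RatFunc M) (Localization.AtPrime 𝔭) RatFunc.X) ≠ 0 := by
  haveI : Algebra.FinitePresentation (RatFunc M) A :=
    (Algebra.FinitePresentation.of_finiteType (R := RatFunc M) (A := A)).mp inferInstance
  have hS : Algebra.Smooth (RatFunc M) A ↔ Algebra.FormallySmooth (RatFunc M) A :=
    ⟨fun h => h.formallySmooth, fun h => ⟨h, inferInstance⟩⟩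
  rw [hS, ← Algebra.smoothLocus_eq_univ_iff, Set.eq_univ_iff_forall]
  constructor
  · intro h 𝔭 h𝔭
    haveI : Algebra.IsSmoothAt (RatFunc M) 𝔭 := h ⟨𝔭, h𝔭⟩
    exact (ratFunc_isSmoothAt_iff_tmul_D_ne_zero M A 𝔭).mp this
  · intro h 𝔭
    exact (ratFunc_isSmoothAt_iff_tmul_D_ne_zero M A 𝔭.asIdeal).mpr (h 𝔭.asIdeal)

end SlotAlgebra

end Summit.ResolutionOfSingularities.ResolutionOfSingularities.Theorems.CampaignW82
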